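import Summits.QuantumFields.YangMills.Theorems.BalabanUVNodesN11NoExpansionOldFactors
import Literature.MathematicalPhysics.QuantumFieldTheory.Balaban1983to89.Node00.Record12LocalLawsTwoScale

/-!
# DAG node N11 — THE NO-EXPANSION 𝐓-STEP AFTER AN ARBITRARY HISTORY AT THE v1.7 `CoPH` RECORD (generic `θ : Stage13HParams`): the level-`k` §2 dichotomy at
# `init s′` — history's residual `θ.rzAt p (init s′)`, weights `WtOfRecord₁₃H θ p (init s′)` over `θ.Zh p k …` — gives the 𝐓-image dichotomy at `s′`
# (`Ω_{k+1}(s′) = ∅`, ANY `Ω_1, …, Ω_k`) — history's residual `θ.rzAt p s′`, weights `WtOfRecord₁₃H θ p s′` over `θ.Zh p (k+1) …` — SAME witness `t`, SAME constant,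
# under: the prefix agreement of the two residual slots below generation `k`, the generation-`k` pin WITH THE OLD FRONT FACTOR on `θ.zhAt p s′`, `quad_k(∅) = 0`
# there, the displayed scale-localities, and the displayed measurability ∕ bound of the new integrand

Cell `pub-ymgap`, YM-PLAN Track A (HUMAN RULING D-0062), seat `pub-ymgap-dag-n11-d` (g8; R134 fan-out seat N11 [B14], strategy s2), route `BalabanUVNodes`
rev 23→24, item K1⁶ `StabilityBAtRecordR13SepCoPR` = stmt-QuantumFields-20507 (helper, count-neutral; ⁷ re-key by name at KEY-24).  [III] = [Balaban1988Convergent].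
Sequel of `…NoExpansionOldFactors` (§3 `clause_succ_of_Omega_empty_of_prefix_of_clause`) over node00-def-T's FILE 27 `Node00/Record13CoPH` (p537939) and this
seat's `…NoExpansionDiagonalAtZ` (p532335: the weight faces over a residual), `…TkBranchWeightCongr` (p536516: (PC) faces), `…NoExpansionDiagonalCoPH` (g8: `rfl` faces).

WHY THIS FILE.  It is the v1.7 form of N11's 𝐓-step off the diagonal: for EVERY old history and an all-large new step, what the K1 consumer of `TLaw₁₃CoPH θ p k`
needs at `s′` follows from `SLaw₁₃CoPH θ p k`'s clause at `init s′` ONCE the witness `θ.Zh` has two properties at `(p, k+1, s′.Ω, s′.Λ)`: (P) PREFIX — below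
generation `k` it agrees with `θ.Zh p k (init s′).Ω (init s′).Λ` (director-ym №186 (2): the component of the last large-field region is untouched by R^{(k+1)};
at the history-blind door `rfl`); (V) VALUE at generation `k` — `ζ0_k(T)(U, V′) = χ_k(Ω_k(init s′))(U)·w_k(s′)(U, Ū)`, `quad_k(∅) = 0` (the history-indexed pin
FINDING №9 made typable; H3, node00-def-K0a∕K0b's lane).  Both are HYPOTHESES here; of g7's two displayed scale-localities the one on the A-side weights is DISCHARGED down to the residual (§0: 12a's `χA_j`
reads the scales `j`, `j+1` only — `chiAW_local_of_lt`; what remains is `hqloc`, `k`-locality of `(θ.zhAt p s′).quad j`, `j < k`, a property of the witness's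
Gaussian placeholder), the other (`hA`, the old action's fluctuation argument — the 𝐁-terms of (2.40)) stays displayed.

WHAT THIS FILE PROVES (0 `sorry`, 0 `def`, standard axioms; `N`-generic).  §0 `chiAW_local_of_lt` · `tkWeightsOfRecordP_w_local_of_quad_local`.  §1
`zhAt_eq_zhAt_init_of_levelFree_of_Omega_empty` ∕ `prefix_agree_of_levelFree_of_Omega_empty` ((P) is AUTOMATIC for a length-free `Zh` value at a no-expansion step) · ★★
`clause_succ_CoPH_of_Omega_empty_of_pinChi_of_clause` (as above; `hqloc` in place of g7's `hwloc`) ·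
`clause_succ_CoPH_of_Omega_empty_of_pinChi_of_provisos_of_clause` (keyed on `Provisos₁₃CoPH`: `hloc` from `zhLocal`) · `exists_clause_succ_CoPH_of_Omega_empty_of_sLaw₁₃CoPH`
(keyed on `SLaw₁₃CoPH θ p k` itself: its witness `(t, E_k)` at `init s′` supplies `hid`; conclusion `∃ E′`, witness `t (init s′)`) ·
`clause_succ_CoPH_of_Omega_empty_of_pinChi_of_BLocal_of_clause` (`hA` discharged from the displayed scale-locality `hB` of the witness's 𝐁-terms).

HONEST FRAMING ∕ A6 (director-ym №189 (3)).  Count-neutral kernel bookkeeping; displayed binders: `hpre` (`rfl` at the door `ofHistoryBlind`), `hZ`∕`hq` (VALUE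
statements on `θ.Zh` — inhabited on the diagonal by K0a's cured residual through the door, where `χ_k ≡ 1`; in general H3, not exhibited), `hqloc`∕`hA` (locality
properties of the witness's `quad` ∕ 𝐁-terms, not exhibited; vacuous on the diagonal), `hid` (the clause of `SLaw₁₃CoPH θ p k`), `hm`∕`hC` (measurability ∕ bound — properties, not exhibited).  NOT
`TLaw₁₃CoPH θ p k` (sequences with `Ω_{k+1}(s′) ≠ ∅` are [III] §3 + Thm 2 proper), NOT a witness; nothing of Bałaban's asserted; N11 NOT discharged; counts unmoved
(typed 28∕28 · discharged 5∕28).  One finite four-torus programme at fixed `ε = L^{−K}`; NOT ℝ⁴, NOT OS, NOT a mass gap, NOT Clay.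
Sources: [III] (2.18) p.257, (2.20)–(2.25) pp.258–259, (2.40) p.261, (3.1) p.264, (3.16) p.268, (3.21) p.269, (3.24)–(3.25) p.270, Theorem p.245, Thm 1 p.262;
[IV] (0.2)–(0.3) p.176.
-/

noncomputable section

open MeasureTheory
open scoped BigOperators Matrix.Norms.L2Operator

namespace Summit.QuantumFields.YangMills.Theorems.BalabanUVNodesN11NoExpansionGeneralStepCoPH

open Literature.MathematicalPhysics.QuantumFieldTheory.Balaban1983to89 T4Continuum Node00 Node00.Tk DagBinding
open B15DeterminingSets
open BalabanUVNodesN11NoExpansionDiagonalAtZ (tkWeightsOfRecordP_ζ_apply tkWeightsOfRecordP_w_empty tkWeightsOfRecordP_ζ_local)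
open BalabanUVNodesN11TkBranchWeightCongr (tkWeightsOfRecordP_ζ_congr tkWeightsOfRecordP_w_congr)
open BalabanUVNodesN11NoExpansionOldFactors (clause_succ_of_Omega_empty_of_prefix_of_clause action23_congr_fluct_of_B_local)
open BalabanUVNodesN11NoExpansionDiagonalCoPH (WtOfRecord₁₃H_eq_tkWeightsOfRecordP)
open BalabanUVNodesN11NoExpansionActionSucc (seq_init_Ω_eq_of_Omega_empty seq_init_Λ_eq_of_Omega_empty)

variable {F : T4Family} {N : ℕ} [NeZero N]

/-! ## §0. Scale-locality of 12a's A-side factor below generation `k`; the history's `w_j` is `k`-local when `quad_j` is -/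

section Locality

variable {ν : Stage7Numerics} {A₁ : ℝ} {p : B12.RunParams} {g : ℕ → ℝ}

/-- **12a's (3.21) FACTOR `χA_j(Y, S)` READS THE SCALES `j` AND `j+1` ONLY** (`χ^{(j)}`, `χ^{(j)c}` read `A_j = (ω j).2`; `χ′_j` reads `(ω j).1`, `(ω (j+1)).1`),
hence it is `k`-local for `j < k`. [cite: Balaban1988Convergent, (3.16) p.268, (3.20)–(3.21) p.269, (3.3) p.265] -/
theorem chiAW_local_of_lt {k j : ℕ} (hj : j < k) (Y S : Set (Site (F.P p.K) 0)) (ω ω' : MultiCfg (F.P p.K) (SU N) (FluctV N))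
    (h : ∀ i, i ≤ k → ω i = ω' i) : chiAW F N (FluctV N) ν A₁ p g j Y S ω = chiAW F N (FluctV N) ν A₁ p g j Y S ω' := by
  unfold chiAW chiSmallAW chiLargeAW chiPrimeW
  rw [h j (le_of_lt hj), h (j + 1) hj]

/-- **THE WEIGHT `w_j = χA_j·e^{−quad_j∕2}` OF 12a″'s WEIGHTS OVER `Z` IS `k`-LOCAL FOR `j < k` AS SOON AS `quad_j` IS** (the residual's Gaussian placeholder carries
no locality law in the tree; displayed). [cite: Balaban1988Convergent, (2.21) p.258, (3.21) p.269] -/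
theorem tkWeightsOfRecordP_w_local_of_quad_local (Z : TkResidualW F N (FluctV N) p.K) {k j : ℕ} (hj : j < k) (Λ' Y S : Set (Site (F.P p.K) 0))
    (hq : ∀ ω ω' : MultiCfg (F.P p.K) (SU N) (FluctV N), (∀ i, i ≤ k → ω i = ω' i) → Z.quad j Λ' ω = Z.quad j Λ' ω')
    (ω ω' : MultiCfg (F.P p.K) (SU N) (FluctV N)) (h : ∀ i, i ≤ k → ω i = ω' i) :
    (tkWeightsOfRecordP F N (FluctV N) ν A₁ p g Z).w j Λ' Y S ω = (tkWeightsOfRecordP F N (FluctV N) ν A₁ p g Z).w j Λ' Y S ω' := by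
  show chiAW F N (FluctV N) ν A₁ p g j Y S ω * Real.exp (-(1 / 2 : ℝ) * Z.quad j Λ' ω) =
    chiAW F N (FluctV N) ν A₁ p g j Y S ω' * Real.exp (-(1 / 2 : ℝ) * Z.quad j Λ' ω')
  rw [chiAW_local_of_lt hj Y S ω ω' h, hq ω ω' h]

end Locality

section CoPH

variable (θ : Stage13HParams F N) (p : B12.RunParams)

/-- **(P) IS AUTOMATIC AT A NO-EXPANSION STEP FOR A LEVEL-FREE SLOT VALUE**: if the witness's `Zh p n Ω Λ` does not read the length index `n`, then at `s′` with
`Ω_{k+1}(s′) = ∅` the residual serving `s′` IS the residual serving `init s′` — `init s′` and `s′` have the same region FUNCTIONS (p531413) — so the prefix agreement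
`hpre` below holds with equality of the whole residual (g7's refinement of the DESIGN-INPUT «PREFIX LAW»; node00-def-K0a∕K0b: a length-free H3 value needs no prefix
lemma on the no-expansion steps). [cite: Balaban1988Convergent, (2.1) p.254, p.257, (2.20)–(2.22) p.258] -/
theorem zhAt_eq_zhAt_init_of_levelFree_of_Omega_empty (hZh : ∀ (n n' : ℕ) (Ω Λ : ℕ → Set (Site (F.P p.K) 0)), θ.Zh p n Ω Λ = θ.Zh p n' Ω Λ) {k : ℕ}
    (s : SeqOfRecord F θ.ν θ.τ9.M (gOfRecord₁₃ F N θ.toStage13Params p) p.K (k + 1)) (hΩ : s.Ω (k + 1) = ∅) :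
    θ.zhAt p s = θ.zhAt p s.init := by
  show θ.Zh p (k + 1) s.Ω s.Λ = θ.Zh p k s.init.Ω s.init.Λ
  rw [seq_init_Ω_eq_of_Omega_empty s hΩ, seq_init_Λ_eq_of_Omega_empty s hΩ]
  exact hZh _ _ _ _

/-- … hence the prefix agreement `hpre` of the step theorems, for every `j`. [cite: Balaban1988Convergent, p.257 (bookkeeping)] -/
theorem prefix_agree_of_levelFree_of_Omega_empty (hZh : ∀ (n n' : ℕ) (Ω Λ : ℕ → Set (Site (F.P p.K) 0)), θ.Zh p n Ω Λ = θ.Zh p n' Ω Λ) {k : ℕ}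
    (s : SeqOfRecord F θ.ν θ.τ9.M (gOfRecord₁₃ F N θ.toStage13Params p) p.K (k + 1)) (hΩ : s.Ω (k + 1) = ∅) :
    ∀ j, j < k → (θ.zhAt p s).ζ0 j = (θ.zhAt p s.init).ζ0 j ∧ (θ.zhAt p s).quad j = (θ.zhAt p s.init).quad j := fun _ _ => by
  rw [zhAt_eq_zhAt_init_of_levelFree_of_Omega_empty θ p hZh s hΩ]
  exact ⟨rfl, rfl⟩

/-- **★★ THE NO-EXPANSION 𝐓-STEP AFTER AN ARBITRARY HISTORY AT THE v1.7 `CoPH` RECORD, CLAUSE-KEYED, GENERIC `θ : Stage13HParams`.**  See the module header: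
`hid` at `init s′` (history's residual and weights of `init s′`) ⇒ the 𝐓-image clause at `s′` (history's residual and weights of `s′`), same `t`, same `E₀`, under
(P) `hpre`, (V) `hZ` + `hq`, locality `hloc` ∕ `hqloc` ∕ `hA`, and `hm` ∕ `hC`. [cite: Balaban1988Convergent, Theorem p.245, (3.24)–(3.25) p.270, (2.18) p.257, (2.20)–(2.25) pp.258–259, (3.16) p.268; Balaban1989LargeFieldI, (0.2)–(0.3) p.176] -/
theorem clause_succ_CoPH_of_Omega_empty_of_pinChi_of_clause {k : ℕ} (hk : k < p.K) (hM : 1 ≤ θ.τ9.M)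
    (s : SeqOfRecord F θ.ν θ.τ9.M (gOfRecord₁₃ F N θ.toStage13Params p) p.K (k + 1)) (hΩ : s.Ω (k + 1) = ∅)
    (hloc : (θ.zhAt p s).LocalLaws)
    (hqloc : ∀ j, j < k → ∀ ω ω' : MultiCfg (F.P p.K) (SU N) (FluctV N), (∀ i, i ≤ k → ω i = ω' i) →
      (θ.zhAt p s).quad j (s.init.Λ (j + 1)) ω = (θ.zhAt p s).quad j (s.init.Λ (j + 1)) ω')
    (hpre : ∀ j, j < k → (θ.zhAt p s).ζ0 j = (θ.zhAt p s.init).ζ0 j ∧ (θ.zhAt p s).quad j = (θ.zhAt p s.init).quad j)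
    (t : Sect2.TermValues (F.P p.K) (MatA N) (FluctV N) θ.τ9.M) (E₀ : ℝ)
    (hA : ∀ (S : ℕ → Set (Site (F.P p.K) 0)) (a a' : Tk.MSFluct (F.P p.K) (FluctV N)) (Uf : GaugeField (F.P p.K) 0 (SU N)), (∀ i, i ≤ k → a i = a' i) →
      (sect2ActionDataOfRecord F N (FluctV N) p.K (settingOfRecord₁₃ F N θ.toStage13Params p) (θ.rzAt p s.init) s.init t (S, a) E₀).action23 k Uf =
        (sect2ActionDataOfRecord F N (FluctV N) p.K (settingOfRecord₁₃ F N θ.toStage13Params p) (θ.rzAt p s.init) s.init t (S, a') E₀).action23 k Uf)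
    (hid : slotsOfRecord F N θ.ν θ.τ9 (EOfRecord₁₃ F N θ.toStage13Params) (wOfRecord₉ F N θ.toStage9Params) θ.ppSel p
        (gOfRecord₁₃ F N θ.toStage13Params p) k s.init = 0 ∨
      ∀ᵐ U₀ ∂fieldMeasure (F.P p.K) k (SU N),
        chiSeqOfRecord F N θ.ν θ.τ9.M (gOfRecord₁₃ F N θ.toStage13Params p) p.K k s.init U₀ ≠ 0 →
          slotsOfRecord F N θ.ν θ.τ9 (EOfRecord₁₃ F N θ.toStage13Params) (wOfRecord₉ F N θ.toStage9Params) θ.ppSel p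
              (gOfRecord₁₃ F N θ.toStage13Params p) k s.init U₀ =
            sect2Slot F N (FluctV N) p.K (settingOfRecord₁₃ F N θ.toStage13Params p) (θ.rzAt p s.init) (WtOfRecord₁₃H F N θ p s.init) s.init t E₀
              (UbgOfRecord₁₃CoP F N θ.toStage13Params p k s.init) U₀)
    (hZ : ∀ (V' : GaugeField (F.P p.K) (k + 1) (SU N)) (U₀ : GaugeField (F.P p.K) k (SU N)),
      (θ.zhAt p s).ζ0 k Set.univ (pairCfgAt (V := FluctV N) k V' U₀) =
        chiSeqOfRecord F N θ.ν θ.τ9.M (gOfRecord₁₃ F N θ.toStage13Params p) p.K k s.init U₀ *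
          wOfRecord₉ F N θ.toStage9Params p (gOfRecord₁₃ F N θ.toStage13Params p) k s U₀ ((avOfRecord F N p.K k).avg U₀))
    (hq : ∀ (V' : GaugeField (F.P p.K) (k + 1) (SU N)) (U₀ : GaugeField (F.P p.K) k (SU N)), (θ.zhAt p s).quad k ∅ (pairCfgAt (V := FluctV N) k V' U₀) = 0)
    {C : ℝ}
    (hm : ∀ S ∈ admSOfRecord F θ.ν θ.τ9.M (gOfRecord₁₃ F N θ.toStage13Params p) p.K k s.init,
      Measurable (Function.uncurry (noExpIntegrandAt F N (FluctV N) p.K k (WtOfRecord₁₃H F N θ p s)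
        (tkBranchOfRecord F N (FluctV N) θ.ν θ.τ9.M _ p.K (WtOfRecord₁₃H F N θ p s) s.init S k
          (fun ω => sect2Operand F N (FluctV N) p.K (settingOfRecord₁₃ F N θ.toStage13Params p) (θ.rzAt p s) s t E₀
            (UbgOfRecord₁₃CoP F N θ.toStage13Params p (k + 1) s) (S, fun j => (ω j).2) (fun j => (ω j).1))))))
    (hC : ∀ S ∈ admSOfRecord F θ.ν θ.τ9.M (gOfRecord₁₃ F N θ.toStage13Params p) p.K k s.init, ∀ V' U₀,
      |noExpIntegrandAt F N (FluctV N) p.K k (WtOfRecord₁₃H F N θ p s)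
        (tkBranchOfRecord F N (FluctV N) θ.ν θ.τ9.M _ p.K (WtOfRecord₁₃H F N θ p s) s.init S k
          (fun ω => sect2Operand F N (FluctV N) p.K (settingOfRecord₁₃ F N θ.toStage13Params p) (θ.rzAt p s) s t E₀
            (UbgOfRecord₁₃CoP F N θ.toStage13Params p (k + 1) s) (S, fun j => (ω j).2) (fun j => (ω j).1)))
        V' U₀| ≤ C) :
    slotsTOfRecord F N θ.ν θ.τ9 (EOfRecord₁₃ F N θ.toStage13Params) (wOfRecord₉ F N θ.toStage9Params) θ.ppSel p
        (gOfRecord₁₃ F N θ.toStage13Params p) (k + 1) s = 0 ∨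
      ∀ᵐ V' ∂fieldMeasure (F.P p.K) (k + 1) (SU N),
        chiSeqOfRecord F N θ.ν θ.τ9.M (gOfRecord₁₃ F N θ.toStage13Params p) p.K (k + 1) s V' ≠ 0 →
          slotsTOfRecord F N θ.ν θ.τ9 (EOfRecord₁₃ F N θ.toStage13Params) (wOfRecord₉ F N θ.toStage9Params) θ.ppSel p
              (gOfRecord₁₃ F N θ.toStage13Params p) (k + 1) s V' =
            sect2Slot F N (FluctV N) p.K (settingOfRecord₁₃ F N θ.toStage13Params p) (θ.rzAt p s) (WtOfRecord₁₃H F N θ p s) s t E₀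
              (UbgOfRecord₁₃CoP F N θ.toStage13Params p (k + 1) s) V' := by
  -- (P) at the level of 12a″'s weights: prefix agreement of `ζ_j`, `w_j`, `j < k`
  have hpre' : ∀ j, j < k → (WtOfRecord₁₃H F N θ p s).ζ j = (WtOfRecord₁₃H F N θ p s.init).ζ j ∧
      (WtOfRecord₁₃H F N θ p s).w j = (WtOfRecord₁₃H F N θ p s.init).w j := fun j hj =>
    ⟨tkWeightsOfRecordP_ζ_congr θ.ν θ.A₁ p (gOfRecord₁₃ F N θ.toStage13Params p) (θ.zhAt p s) (θ.zhAt p s.init) j (hpre j hj).1,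
      tkWeightsOfRecordP_w_congr θ.ν θ.A₁ p (gOfRecord₁₃ F N θ.toStage13Params p) (θ.zhAt p s) (θ.zhAt p s.init) j (hpre j hj).2⟩
  -- 12b locality of the history's residual ⇒ `k`-locality of `ζ_j`, `j < k`
  have hζloc : ∀ j, j < k → ∀ ω ω' : MultiCfg (F.P p.K) (SU N) (FluctV N), (∀ i, i ≤ k → ω i = ω' i) →
      (WtOfRecord₁₃H F N θ p s).ζ j (s.init.Ω (j + 1))ᶜ ω = (WtOfRecord₁₃H F N θ p s).ζ j (s.init.Ω (j + 1))ᶜ ω' :=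
    fun _ hj ω ω' h => hloc.localLaws₂.zeta0_local_lt hj _ ω ω' h
  -- 12a's A-side factor reads scales `j`, `j+1`; the residual's `quad_j` is `k`-local by `hqloc` ⇒ `w_j` is `k`-local, `j < k`
  have hwloc : ∀ (S : ℕ → Set (Site (F.P p.K) 0)) (j : ℕ), j < k → ∀ ω ω' : MultiCfg (F.P p.K) (SU N) (FluctV N), (∀ i, i ≤ k → ω i = ω' i) →
      (WtOfRecord₁₃H F N θ p s).w j (s.init.Λ (j + 1)) ((s.init.Λ (j + 1))ᶜ ∩ s.init.Ω (j + 1)) (S (j + 1)) ω =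
        (WtOfRecord₁₃H F N θ p s).w j (s.init.Λ (j + 1)) ((s.init.Λ (j + 1))ᶜ ∩ s.init.Ω (j + 1)) (S (j + 1)) ω' :=
    fun S j hj ω ω' h => tkWeightsOfRecordP_w_local_of_quad_local (θ.zhAt p s) hj _ _ _ (hqloc j hj) ω ω' h
  -- (V) the generation-`k` ζ-spec with the old front factor
  have hζχ : ∀ U₀ : GaugeField (F.P p.K) k (SU N),
      (WtOfRecord₁₃H F N θ p s).ζ k Set.univ (pairCfgAt (V := FluctV N) k ((avOfRecord F N p.K k).avg U₀) U₀) *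
          (WtOfRecord₁₃H F N θ p s).w k ∅ ∅ ∅ (pairCfgAt (V := FluctV N) k ((avOfRecord F N p.K k).avg U₀) U₀) =
        chiSeqOfRecord F N θ.ν θ.τ9.M (gOfRecord₁₃ F N θ.toStage13Params p) p.K k s.init U₀ *
          wOfRecord₉ F N θ.toStage9Params p (gOfRecord₁₃ F N θ.toStage13Params p) k s U₀ ((avOfRecord F N p.K k).avg U₀) := by
    intro U₀
    rw [WtOfRecord₁₃H_eq_tkWeightsOfRecordP, tkWeightsOfRecordP_ζ_apply, tkWeightsOfRecordP_w_empty, hq, mul_zero, Real.exp_zero, mul_one]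
    exact hZ _ _
  exact clause_succ_of_Omega_empty_of_prefix_of_clause θ.toStage13Params p hk hM s hΩ (WtOfRecord₁₃H F N θ p s) (WtOfRecord₁₃H F N θ p s.init)
    hpre' hζloc hwloc (θ.rzAt p s.init) (θ.rzAt p s) t E₀ hA hid hζχ hm hC

/-- **… keyed on def-T's v1.7 core provisos** (`zhLocal` supplies `hloc`). [cite: Balaban1988Convergent, Theorem p.245, (3.24)–(3.25) p.270, (3.2)–(3.9) pp.265–266] -/
theorem clause_succ_CoPH_of_Omega_empty_of_pinChi_of_provisos_of_clause (h : θ.Provisos₁₃CoPH F N) {k : ℕ} (hk : k < p.K) (hM : 1 ≤ θ.τ9.M)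
    (s : SeqOfRecord F θ.ν θ.τ9.M (gOfRecord₁₃ F N θ.toStage13Params p) p.K (k + 1)) (hΩ : s.Ω (k + 1) = ∅)
    (hqloc : ∀ j, j < k → ∀ ω ω' : MultiCfg (F.P p.K) (SU N) (FluctV N), (∀ i, i ≤ k → ω i = ω' i) →
      (θ.zhAt p s).quad j (s.init.Λ (j + 1)) ω = (θ.zhAt p s).quad j (s.init.Λ (j + 1)) ω')
    (hpre : ∀ j, j < k → (θ.zhAt p s).ζ0 j = (θ.zhAt p s.init).ζ0 j ∧ (θ.zhAt p s).quad j = (θ.zhAt p s.init).quad j)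
    (t : Sect2.TermValues (F.P p.K) (MatA N) (FluctV N) θ.τ9.M) (E₀ : ℝ)
    (hA : ∀ (S : ℕ → Set (Site (F.P p.K) 0)) (a a' : Tk.MSFluct (F.P p.K) (FluctV N)) (Uf : GaugeField (F.P p.K) 0 (SU N)), (∀ i, i ≤ k → a i = a' i) →
      (sect2ActionDataOfRecord F N (FluctV N) p.K (settingOfRecord₁₃ F N θ.toStage13Params p) (θ.rzAt p s.init) s.init t (S, a) E₀).action23 k Uf =
        (sect2ActionDataOfRecord F N (FluctV N) p.K (settingOfRecord₁₃ F N θ.toStage13Params p) (θ.rzAt p s.init) s.init t (S, a') E₀).action23 k Uf)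
    (hid : slotsOfRecord F N θ.ν θ.τ9 (EOfRecord₁₃ F N θ.toStage13Params) (wOfRecord₉ F N θ.toStage9Params) θ.ppSel p
        (gOfRecord₁₃ F N θ.toStage13Params p) k s.init = 0 ∨
      ∀ᵐ U₀ ∂fieldMeasure (F.P p.K) k (SU N),
        chiSeqOfRecord F N θ.ν θ.τ9.M (gOfRecord₁₃ F N θ.toStage13Params p) p.K k s.init U₀ ≠ 0 →
          slotsOfRecord F N θ.ν θ.τ9 (EOfRecord₁₃ F N θ.toStage13Params) (wOfRecord₉ F N θ.toStage9Params) θ.ppSel p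
              (gOfRecord₁₃ F N θ.toStage13Params p) k s.init U₀ =
            sect2Slot F N (FluctV N) p.K (settingOfRecord₁₃ F N θ.toStage13Params p) (θ.rzAt p s.init) (WtOfRecord₁₃H F N θ p s.init) s.init t E₀
              (UbgOfRecord₁₃CoP F N θ.toStage13Params p k s.init) U₀)
    (hZ : ∀ (V' : GaugeField (F.P p.K) (k + 1) (SU N)) (U₀ : GaugeField (F.P p.K) k (SU N)),
      (θ.zhAt p s).ζ0 k Set.univ (pairCfgAt (V := FluctV N) k V' U₀) =
        chiSeqOfRecord F N θ.ν θ.τ9.M (gOfRecord₁₃ F N θ.toStage13Params p) p.K k s.init U₀ *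
          wOfRecord₉ F N θ.toStage9Params p (gOfRecord₁₃ F N θ.toStage13Params p) k s U₀ ((avOfRecord F N p.K k).avg U₀))
    (hq : ∀ (V' : GaugeField (F.P p.K) (k + 1) (SU N)) (U₀ : GaugeField (F.P p.K) k (SU N)), (θ.zhAt p s).quad k ∅ (pairCfgAt (V := FluctV N) k V' U₀) = 0)
    {C : ℝ}
    (hm : ∀ S ∈ admSOfRecord F θ.ν θ.τ9.M (gOfRecord₁₃ F N θ.toStage13Params p) p.K k s.init,
      Measurable (Function.uncurry (noExpIntegrandAt F N (FluctV N) p.K k (WtOfRecord₁₃H F N θ p s)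
        (tkBranchOfRecord F N (FluctV N) θ.ν θ.τ9.M _ p.K (WtOfRecord₁₃H F N θ p s) s.init S k
          (fun ω => sect2Operand F N (FluctV N) p.K (settingOfRecord₁₃ F N θ.toStage13Params p) (θ.rzAt p s) s t E₀
            (UbgOfRecord₁₃CoP F N θ.toStage13Params p (k + 1) s) (S, fun j => (ω j).2) (fun j => (ω j).1))))))
    (hC : ∀ S ∈ admSOfRecord F θ.ν θ.τ9.M (gOfRecord₁₃ F N θ.toStage13Params p) p.K k s.init, ∀ V' U₀,
      |noExpIntegrandAt F N (FluctV N) p.K k (WtOfRecord₁₃H F N θ p s)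
        (tkBranchOfRecord F N (FluctV N) θ.ν θ.τ9.M _ p.K (WtOfRecord₁₃H F N θ p s) s.init S k
          (fun ω => sect2Operand F N (FluctV N) p.K (settingOfRecord₁₃ F N θ.toStage13Params p) (θ.rzAt p s) s t E₀
            (UbgOfRecord₁₃CoP F N θ.toStage13Params p (k + 1) s) (S, fun j => (ω j).2) (fun j => (ω j).1)))
        V' U₀| ≤ C) :
    slotsTOfRecord F N θ.ν θ.τ9 (EOfRecord₁₃ F N θ.toStage13Params) (wOfRecord₉ F N θ.toStage9Params) θ.ppSel p
        (gOfRecord₁₃ F N θ.toStage13Params p) (k + 1) s = 0 ∨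
      ∀ᵐ V' ∂fieldMeasure (F.P p.K) (k + 1) (SU N),
        chiSeqOfRecord F N θ.ν θ.τ9.M (gOfRecord₁₃ F N θ.toStage13Params p) p.K (k + 1) s V' ≠ 0 →
          slotsTOfRecord F N θ.ν θ.τ9 (EOfRecord₁₃ F N θ.toStage13Params) (wOfRecord₉ F N θ.toStage9Params) θ.ppSel p
              (gOfRecord₁₃ F N θ.toStage13Params p) (k + 1) s V' =
            sect2Slot F N (FluctV N) p.K (settingOfRecord₁₃ F N θ.toStage13Params p) (θ.rzAt p s) (WtOfRecord₁₃H F N θ p s) s t E₀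
              (UbgOfRecord₁₃CoP F N θ.toStage13Params p (k + 1) s) V' :=
  clause_succ_CoPH_of_Omega_empty_of_pinChi_of_clause θ p hk hM s hΩ (h.zhLocal p (k + 1) s.Ω s.Λ) hqloc hpre t E₀ hA hid hZ hq hm hC

/-- **… keyed on `SLaw₁₃CoPH θ p k` ITSELF**: its witness `(t, E_k)` supplies `hid` at `init s′`; the 𝐓-image clause at `s′` then holds for the witness `t (init s′)`
with `E_{k+1}(s′) := E_k(init s′)` (`hA`, `hm`, `hC` displayed for every `(t₀, E₀)`). [cite: Balaban1988Convergent, Theorem p.245, Thm 1 p.262, (3.24)–(3.25) p.270] -/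
theorem exists_clause_succ_CoPH_of_Omega_empty_of_sLaw₁₃CoPH (h : θ.Provisos₁₃CoPH F N) {k : ℕ} (hk : k < p.K) (hM : 1 ≤ θ.τ9.M)
    (hS : SLaw₁₃CoPH F N θ p k)
    (s : SeqOfRecord F θ.ν θ.τ9.M (gOfRecord₁₃ F N θ.toStage13Params p) p.K (k + 1)) (hΩ : s.Ω (k + 1) = ∅)
    (hqloc : ∀ j, j < k → ∀ ω ω' : MultiCfg (F.P p.K) (SU N) (FluctV N), (∀ i, i ≤ k → ω i = ω' i) →
      (θ.zhAt p s).quad j (s.init.Λ (j + 1)) ω = (θ.zhAt p s).quad j (s.init.Λ (j + 1)) ω')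
    (hpre : ∀ j, j < k → (θ.zhAt p s).ζ0 j = (θ.zhAt p s.init).ζ0 j ∧ (θ.zhAt p s).quad j = (θ.zhAt p s.init).quad j)
    (hA : ∀ (t₀ : Sect2.TermValues (F.P p.K) (MatA N) (FluctV N) θ.τ9.M) (E₀ : ℝ) (S : ℕ → Set (Site (F.P p.K) 0))
      (a a' : Tk.MSFluct (F.P p.K) (FluctV N)) (Uf : GaugeField (F.P p.K) 0 (SU N)), (∀ i, i ≤ k → a i = a' i) →
      (sect2ActionDataOfRecord F N (FluctV N) p.K (settingOfRecord₁₃ F N θ.toStage13Params p) (θ.rzAt p s.init) s.init t₀ (S, a) E₀).action23 k Uf =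
        (sect2ActionDataOfRecord F N (FluctV N) p.K (settingOfRecord₁₃ F N θ.toStage13Params p) (θ.rzAt p s.init) s.init t₀ (S, a') E₀).action23 k Uf)
    (hZ : ∀ (V' : GaugeField (F.P p.K) (k + 1) (SU N)) (U₀ : GaugeField (F.P p.K) k (SU N)),
      (θ.zhAt p s).ζ0 k Set.univ (pairCfgAt (V := FluctV N) k V' U₀) =
        chiSeqOfRecord F N θ.ν θ.τ9.M (gOfRecord₁₃ F N θ.toStage13Params p) p.K k s.init U₀ *
          wOfRecord₉ F N θ.toStage9Params p (gOfRecord₁₃ F N θ.toStage13Params p) k s U₀ ((avOfRecord F N p.K k).avg U₀))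
    (hq : ∀ (V' : GaugeField (F.P p.K) (k + 1) (SU N)) (U₀ : GaugeField (F.P p.K) k (SU N)), (θ.zhAt p s).quad k ∅ (pairCfgAt (V := FluctV N) k V' U₀) = 0)
    {C : ℝ}
    (hm : ∀ (t₀ : Sect2.TermValues (F.P p.K) (MatA N) (FluctV N) θ.τ9.M) (E₀ : ℝ),
      ∀ S ∈ admSOfRecord F θ.ν θ.τ9.M (gOfRecord₁₃ F N θ.toStage13Params p) p.K k s.init,
      Measurable (Function.uncurry (noExpIntegrandAt F N (FluctV N) p.K k (WtOfRecord₁₃H F N θ p s)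
        (tkBranchOfRecord F N (FluctV N) θ.ν θ.τ9.M _ p.K (WtOfRecord₁₃H F N θ p s) s.init S k
          (fun ω => sect2Operand F N (FluctV N) p.K (settingOfRecord₁₃ F N θ.toStage13Params p) (θ.rzAt p s) s t₀ E₀
            (UbgOfRecord₁₃CoP F N θ.toStage13Params p (k + 1) s) (S, fun j => (ω j).2) (fun j => (ω j).1))))))
    (hC : ∀ (t₀ : Sect2.TermValues (F.P p.K) (MatA N) (FluctV N) θ.τ9.M) (E₀ : ℝ),
      ∀ S ∈ admSOfRecord F θ.ν θ.τ9.M (gOfRecord₁₃ F N θ.toStage13Params p) p.K k s.init, ∀ V' U₀,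
      |noExpIntegrandAt F N (FluctV N) p.K k (WtOfRecord₁₃H F N θ p s)
        (tkBranchOfRecord F N (FluctV N) θ.ν θ.τ9.M _ p.K (WtOfRecord₁₃H F N θ p s) s.init S k
          (fun ω => sect2Operand F N (FluctV N) p.K (settingOfRecord₁₃ F N θ.toStage13Params p) (θ.rzAt p s) s t₀ E₀
            (UbgOfRecord₁₃CoP F N θ.toStage13Params p (k + 1) s) (S, fun j => (ω j).2) (fun j => (ω j).1)))
        V' U₀| ≤ C) :
    ∃ (t₀ : Sect2.TermValues (F.P p.K) (MatA N) (FluctV N) θ.τ9.M) (E' : ℝ),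
      slotsTOfRecord F N θ.ν θ.τ9 (EOfRecord₁₃ F N θ.toStage13Params) (wOfRecord₉ F N θ.toStage9Params) θ.ppSel p
          (gOfRecord₁₃ F N θ.toStage13Params p) (k + 1) s = 0 ∨
        ∀ᵐ V' ∂fieldMeasure (F.P p.K) (k + 1) (SU N),
          chiSeqOfRecord F N θ.ν θ.τ9.M (gOfRecord₁₃ F N θ.toStage13Params p) p.K (k + 1) s V' ≠ 0 →
            slotsTOfRecord F N θ.ν θ.τ9 (EOfRecord₁₃ F N θ.toStage13Params) (wOfRecord₉ F N θ.toStage9Params) θ.ppSel p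
                (gOfRecord₁₃ F N θ.toStage13Params p) (k + 1) s V' =
              sect2Slot F N (FluctV N) p.K (settingOfRecord₁₃ F N θ.toStage13Params p) (θ.rzAt p s) (WtOfRecord₁₃H F N θ p s) s t₀ E'
                (UbgOfRecord₁₃CoP F N θ.toStage13Params p (k + 1) s) V' := by
  obtain ⟨t, Ek, -, hs⟩ := (sLaw₁₃CoPH_iff F N θ p k).1 hS
  exact ⟨t s.init, Ek s.init, clause_succ_CoPH_of_Omega_empty_of_pinChi_of_provisos_of_clause θ p h hk hM s hΩ hqloc hpre (t s.init) (Ek s.init)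
    (hA _ _) (hs s.init).2 hZ hq (hm _ _) (hC _ _)⟩

/-- **… with `hA` DISCHARGED FROM THE SCALE-LOCALITY OF THE WITNESS's 𝐁-TERMS** (`hB`: `𝐁^{(j)}`, `1 ≤ j ≤ k`, reads the fluctuation variables at scales `≤ k` — the
displayed law a future row on `Sect2.TermValues` would carry; `action23_congr_fluct_of_B_local`). [cite: Balaban1988Convergent, (2.40)–(2.41) p.261, (3.24)–(3.25) p.270] -/
theorem clause_succ_CoPH_of_Omega_empty_of_pinChi_of_BLocal_of_clause (h : θ.Provisos₁₃CoPH F N) {k : ℕ} (hk : k < p.K) (hM : 1 ≤ θ.τ9.M)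
    (s : SeqOfRecord F θ.ν θ.τ9.M (gOfRecord₁₃ F N θ.toStage13Params p) p.K (k + 1)) (hΩ : s.Ω (k + 1) = ∅)
    (hqloc : ∀ j, j < k → ∀ ω ω' : MultiCfg (F.P p.K) (SU N) (FluctV N), (∀ i, i ≤ k → ω i = ω' i) →
      (θ.zhAt p s).quad j (s.init.Λ (j + 1)) ω = (θ.zhAt p s).quad j (s.init.Λ (j + 1)) ω')
    (hpre : ∀ j, j < k → (θ.zhAt p s).ζ0 j = (θ.zhAt p s.init).ζ0 j ∧ (θ.zhAt p s).quad j = (θ.zhAt p s.init).quad j)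
    (t : Sect2.TermValues (F.P p.K) (MatA N) (FluctV N) θ.τ9.M) (E₀ : ℝ)
    (hB : ∀ (S : ℕ → Set (Site (F.P p.K) 0)) (j : ℕ), 1 ≤ j → j ≤ k → ∀ (X : (Sect2.domSys (F.P p.K) θ.τ9.M j).Dom) (u : Sect2.CPair (F.P p.K) (MatA N))
      (a a' : Tk.MSFluct (F.P p.K) (FluctV N)), (∀ i, i ≤ k → a i = a' i) → t.B j X u (S, a) = t.B j X u (S, a'))
    (hid : slotsOfRecord F N θ.ν θ.τ9 (EOfRecord₁₃ F N θ.toStage13Params) (wOfRecord₉ F N θ.toStage9Params) θ.ppSel p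
        (gOfRecord₁₃ F N θ.toStage13Params p) k s.init = 0 ∨
      ∀ᵐ U₀ ∂fieldMeasure (F.P p.K) k (SU N),
        chiSeqOfRecord F N θ.ν θ.τ9.M (gOfRecord₁₃ F N θ.toStage13Params p) p.K k s.init U₀ ≠ 0 →
          slotsOfRecord F N θ.ν θ.τ9 (EOfRecord₁₃ F N θ.toStage13Params) (wOfRecord₉ F N θ.toStage9Params) θ.ppSel p
              (gOfRecord₁₃ F N θ.toStage13Params p) k s.init U₀ =
            sect2Slot F N (FluctV N) p.K (settingOfRecord₁₃ F N θ.toStage13Params p) (θ.rzAt p s.init) (WtOfRecord₁₃H F N θ p s.init) s.init t E₀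
              (UbgOfRecord₁₃CoP F N θ.toStage13Params p k s.init) U₀)
    (hZ : ∀ (V' : GaugeField (F.P p.K) (k + 1) (SU N)) (U₀ : GaugeField (F.P p.K) k (SU N)),
      (θ.zhAt p s).ζ0 k Set.univ (pairCfgAt (V := FluctV N) k V' U₀) =
        chiSeqOfRecord F N θ.ν θ.τ9.M (gOfRecord₁₃ F N θ.toStage13Params p) p.K k s.init U₀ *
          wOfRecord₉ F N θ.toStage9Params p (gOfRecord₁₃ F N θ.toStage13Params p) k s U₀ ((avOfRecord F N p.K k).avg U₀))
    (hq : ∀ (V' : GaugeField (F.P p.K) (k + 1) (SU N)) (U₀ : GaugeField (F.P p.K) k (SU N)), (θ.zhAt p s).quad k ∅ (pairCfgAt (V := FluctV N) k V' U₀) = 0)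
    {C : ℝ}
    (hm : ∀ S ∈ admSOfRecord F θ.ν θ.τ9.M (gOfRecord₁₃ F N θ.toStage13Params p) p.K k s.init,
      Measurable (Function.uncurry (noExpIntegrandAt F N (FluctV N) p.K k (WtOfRecord₁₃H F N θ p s)
        (tkBranchOfRecord F N (FluctV N) θ.ν θ.τ9.M _ p.K (WtOfRecord₁₃H F N θ p s) s.init S k
          (fun ω => sect2Operand F N (FluctV N) p.K (settingOfRecord₁₃ F N θ.toStage13Params p) (θ.rzAt p s) s t E₀
            (UbgOfRecord₁₃CoP F N θ.toStage13Params p (k + 1) s) (S, fun j => (ω j).2) (fun j => (ω j).1))))))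
    (hC : ∀ S ∈ admSOfRecord F θ.ν θ.τ9.M (gOfRecord₁₃ F N θ.toStage13Params p) p.K k s.init, ∀ V' U₀,
      |noExpIntegrandAt F N (FluctV N) p.K k (WtOfRecord₁₃H F N θ p s)
        (tkBranchOfRecord F N (FluctV N) θ.ν θ.τ9.M _ p.K (WtOfRecord₁₃H F N θ p s) s.init S k
          (fun ω => sect2Operand F N (FluctV N) p.K (settingOfRecord₁₃ F N θ.toStage13Params p) (θ.rzAt p s) s t E₀
            (UbgOfRecord₁₃CoP F N θ.toStage13Params p (k + 1) s) (S, fun j => (ω j).2) (fun j => (ω j).1)))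
        V' U₀| ≤ C) :
    slotsTOfRecord F N θ.ν θ.τ9 (EOfRecord₁₃ F N θ.toStage13Params) (wOfRecord₉ F N θ.toStage9Params) θ.ppSel p
        (gOfRecord₁₃ F N θ.toStage13Params p) (k + 1) s = 0 ∨
      ∀ᵐ V' ∂fieldMeasure (F.P p.K) (k + 1) (SU N),
        chiSeqOfRecord F N θ.ν θ.τ9.M (gOfRecord₁₃ F N θ.toStage13Params p) p.K (k + 1) s V' ≠ 0 →
          slotsTOfRecord F N θ.ν θ.τ9 (EOfRecord₁₃ F N θ.toStage13Params) (wOfRecord₉ F N θ.toStage9Params) θ.ppSel p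
              (gOfRecord₁₃ F N θ.toStage13Params p) (k + 1) s V' =
            sect2Slot F N (FluctV N) p.K (settingOfRecord₁₃ F N θ.toStage13Params p) (θ.rzAt p s) (WtOfRecord₁₃H F N θ p s) s t E₀
              (UbgOfRecord₁₃CoP F N θ.toStage13Params p (k + 1) s) V' :=
  clause_succ_CoPH_of_Omega_empty_of_pinChi_of_provisos_of_clause θ p h hk hM s hΩ hqloc hpre t E₀
    (fun S a a' Uf ha => action23_congr_fluct_of_B_local _ _ s.init t E₀ S (hB S) a a' ha Uf) hid hZ hq hm hC

end CoPH

end Summit.QuantumFields.YangMills.Theorems.BalabanUVNodesN11NoExpansionGeneralStepCoPH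

end
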